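import Literature.MathematicalPhysics.QuantumFieldTheory.YangMillsOS
import Literature.MathematicalPhysics.QuantumFieldTheory.LatticeGaugeAsymptotics
import Literature.MathematicalPhysics.QuantumFieldTheory.LatticeGaugeProofs

/-!
# `TunedSequenceExists` — freezing of the Wilson theory on a fixed torus (`β → ∞`)

Support/negative lemma for crux `Summit.QuantumFields.YangMills.Theses.ParabolicTrajectory.
TunedSequenceExists` (item stmt-QuantumFields-10524; cdisprove gen 2, importable extract of the
crux workfile `Summits/QuantumFields/YangMills/Cruxes/TunedSequenceExists/Disproof.lean`):

* `tendsto_laplaceAverage` — abstract Laplace concentration of Gibbs averages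
  `∫ g e^{-βS} dμ / ∫ e^{-βS} dμ → c` (`β → ∞`) on a compact space with a finite open-positive
  reference measure (`S ≥ 0` continuous with a zero, `g` continuous, `g = c` on `{S = 0}`);
* `integral_wilsonMeasure_eq_div` (Wilson expectations as Gibbs averages against product Haar),
  `tendsto_integral_wilsonMeasure`, `latticeConnectedCorr_curvature_tendsto_zero`: on a FIXED torus
  `⟨P ; τ_m P⟩_{β, S} → 0` as `β → ∞` for every compact `G` and faithful unitary `r` — the measure
  freezes on flat configurations, where the action density is constant. This is the upper
  endpoint `N_1(k, β) → 0` of the tuning-by-IVT argument, and the engine of the ceiling theorem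
  `Negative/DominatingFalse.lean` (no tuned witness can have freely diverging couplings).

Imports are route-independent (Literature only; the former `Theses.ParabolicTrajectory` import was unused —
removed 2026-08-27 so that importers, e.g. `Theorems/IR/Negative/FixedMesh/*`, stay outside the theses cone).
-/

noncomputable section

open Filter Topology MeasureTheory
open Literature.MathematicalPhysics.QuantumFieldTheory Literature.MathematicalPhysics.QuantumLattice

namespace Summit.QuantumFields.YangMills.Theorems.TunedSequenceExists.Negative.Freezing

section Laplace

variable {X : Type*} [TopologicalSpace X] [CompactSpace X] [MeasurableSpace X]
  [OpensMeasurableSpace X]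

/-- A continuous real function on a compact space is integrable for a finite measure. -/
theorem integrable_of_continuous (μ : Measure X) [IsFiniteMeasure μ] {f : X → ℝ}
    (hf : Continuous f) : Integrable f μ := by
  obtain ⟨C, hC⟩ := isCompact_univ.exists_bound_of_continuousOn hf.continuousOn
  exact Integrable.of_bound hf.aestronglyMeasurable C (ae_of_all _ fun x => hC x (Set.mem_univ x))

omit [MeasurableSpace X] [OpensMeasurableSpace X] in
/-- Uniform approximation near the zero set: if `g = c` on `{S = 0}` then for every `ε > 0` there
is `δ > 0` with `|g x - c| < ε` whenever `S x < δ` (compactness). -/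
theorem exists_delta_of_eq_on_zeroSet {S g : X → ℝ} (hS : Continuous S) (hg : Continuous g)
    {c : ℝ} (hgc : ∀ x, S x = 0 → g x = c) (hS0 : ∀ x, 0 ≤ S x) {ε : ℝ} (hε : 0 < ε) :
    ∃ δ : ℝ, 0 < δ ∧ ∀ x, S x < δ → |g x - c| < ε := by
  set A : Set X := {x | ε ≤ |g x - c|} with hA
  have hAc : IsCompact A :=
    (isClosed_le continuous_const (continuous_abs.comp (hg.sub continuous_const))).isCompact
  by_cases hne : A.Nonempty
  · obtain ⟨x₁, hx₁, hmin⟩ := hAc.exists_isMinOn hne hS.continuousOn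
    have hpos : 0 < S x₁ := by
      rcases (hS0 x₁).lt_or_eq with h | h
      · exact h
      · exfalso
        have : g x₁ = c := hgc x₁ h.symm
        have hx₁' : ε ≤ |g x₁ - c| := hx₁
        rw [this, sub_self, abs_zero] at hx₁'
        exact absurd hx₁' (not_le.2 hε)
    refine ⟨S x₁, hpos, fun x hx => ?_⟩
    by_contra hcon
    have hxA : x ∈ A := not_lt.1 hcon
    exact absurd (hmin hxA) (not_le.2 hx)
  · refine ⟨1, one_pos, fun x _ => ?_⟩
    by_contra hcon
    exact hne ⟨x, not_lt.1 hcon⟩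

/-- **Abstract Laplace concentration of Gibbs averages.** On a compact space with a finite,
open-positive reference measure, for a continuous `S ≥ 0` with a zero and a continuous `g` that is
constant `= c` on the zero set of `S`, the Gibbs averages `∫ g e^{-βS} / ∫ e^{-βS}` tend to `c` as
`β → ∞`. -/
theorem tendsto_laplaceAverage (μ : Measure X) [IsFiniteMeasure μ] [μ.IsOpenPosMeasure]
    {S g : X → ℝ} (hS : Continuous S) (hg : Continuous g) (hS0 : ∀ x, 0 ≤ S x)
    {x₀ : X} (hx₀ : S x₀ = 0) {c : ℝ} (hgc : ∀ x, S x = 0 → g x = c) :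
    Tendsto (fun β : ℝ => (∫ x, g x * Real.exp (-β * S x) ∂μ) / (∫ x, Real.exp (-β * S x) ∂μ))
      atTop (𝓝 c) := by
  -- notation
  set w : ℝ → X → ℝ := fun β x => Real.exp (-β * S x) with hw
  have hwc : ∀ β, Continuous (w β) := fun β =>
    Real.continuous_exp.comp (continuous_const.mul hS)
  have hw_pos : ∀ β x, 0 < w β x := fun β x => Real.exp_pos _
  have hw_anti : ∀ β x δ, 0 ≤ β → δ ≤ S x → w β x ≤ Real.exp (-β * δ) := fun β x δ hβ hδ => by
    simp only [hw]
    exact Real.exp_le_exp.2 (by nlinarith)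
  -- mass near the zero set
  have hmass : ∀ δ : ℝ, 0 < δ → 0 < μ.real {x | S x < δ} := fun δ hδ => by
    have hopen : IsOpen {x | S x < δ} := isOpen_lt hS continuous_const
    have hne : ({x | S x < δ} : Set X).Nonempty := ⟨x₀, by simp [hx₀, hδ]⟩
    exact ENNReal.toReal_pos (hopen.measure_pos μ hne).ne' (measure_ne_top μ _)
  -- lower bound for the partition function
  have hZ_ge : ∀ β δ : ℝ, 0 ≤ β → 0 < δ →
      Real.exp (-β * δ) * μ.real {x | S x < δ} ≤ ∫ x, w β x ∂μ := fun β δ hβ hδ => by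
    have hms : MeasurableSet {x | S x < δ} := (isOpen_lt hS continuous_const).measurableSet
    calc Real.exp (-β * δ) * μ.real {x | S x < δ}
        = ∫ x, Set.indicator {x | S x < δ} (fun _ => Real.exp (-β * δ)) x ∂μ := by
          rw [integral_indicator_const _ hms, smul_eq_mul, mul_comm]
      _ ≤ ∫ x, w β x ∂μ := by
          refine integral_mono ?_ (integrable_of_continuous μ (hwc β)) fun x => ?_
          · exact (integrable_const _).indicator hms
          · by_cases hx : S x < δ
            · simp only [Set.indicator_of_mem (show x ∈ {x | S x < δ} from hx), hw]
              exact Real.exp_le_exp.2 (by nlinarith [hS0 x])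
            · simp only [Set.indicator_of_notMem (show x ∉ {x | S x < δ} from hx)]
              exact (hw_pos β x).le
  have hZ_pos : ∀ β : ℝ, 0 ≤ β → 0 < ∫ x, w β x ∂μ := fun β hβ =>
    lt_of_lt_of_le (mul_pos (Real.exp_pos _) (hmass 1 one_pos)) (hZ_ge β 1 hβ one_pos)
  -- sup bound on |g - c|
  obtain ⟨B₀, hB₀⟩ := isCompact_univ.exists_bound_of_continuousOn
    (hg.sub continuous_const : Continuous fun x => g x - c).continuousOn
  set B : ℝ := max B₀ 0 with hB
  have hBnn : 0 ≤ B := le_max_right _ _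
  have hgB : ∀ x, |g x - c| ≤ B := fun x =>
    (Real.norm_eq_abs _ ▸ hB₀ x (Set.mem_univ x)).trans (le_max_left _ _)
  -- the ε/2 argument
  refine Metric.tendsto_atTop.2 fun ε hε => ?_
  obtain ⟨δ, hδ, hδε⟩ := exists_delta_of_eq_on_zeroSet hS hg hgc hS0 (half_pos hε)
  set m : ℝ := μ.real {x | S x < δ / 2} with hm
  have hm_pos : 0 < m := hmass _ (half_pos hδ)
  set U : ℝ := μ.real Set.univ with hU
  -- the tail term tends to zero
  have htail : Tendsto (fun β : ℝ => B * U / m * Real.exp (-β * (δ / 2))) atTop (𝓝 0) := by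
    have h1 : Tendsto (fun β : ℝ => -β * (δ / 2)) atTop atBot := by
      have h0 : Tendsto (fun β : ℝ => β * (δ / 2)) atTop atTop :=
        tendsto_id.atTop_mul_const (half_pos hδ)
      refine (tendsto_neg_atTop_atBot.comp h0).congr fun β => ?_
      simp only [Function.comp_apply, neg_mul]
    have h2 := Real.tendsto_exp_atBot.comp h1
    simpa using h2.const_mul (B * U / m)
  obtain ⟨β₁, hβ₁⟩ := eventually_atTop.1 (htail.eventually (gt_mem_nhds (half_pos hε)))
  refine ⟨max β₁ 0, fun β hβ => ?_⟩
  have hβ0 : 0 ≤ β := le_trans (le_max_right _ _) hβ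
  have hβ1 : β₁ ≤ β := le_trans (le_max_left _ _) hβ
  have hZ := hZ_pos β hβ0
  -- pointwise estimate
  have hpt : ∀ x, |(g x - c) * w β x| ≤ ε / 2 * w β x + B * Real.exp (-β * δ) := fun x => by
    rw [abs_mul, abs_of_pos (hw_pos β x)]
    by_cases hx : S x < δ
    · have h1 : |g x - c| * w β x ≤ ε / 2 * w β x :=
        mul_le_mul_of_nonneg_right (hδε x hx).le (hw_pos β x).le
      have h2 : 0 ≤ B * Real.exp (-β * δ) := mul_nonneg hBnn (Real.exp_pos _).le
      linarith
    · have h1 : |g x - c| * w β x ≤ B * Real.exp (-β * δ) :=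
        mul_le_mul (hgB x) (hw_anti β x δ hβ0 (not_lt.1 hx)) (hw_pos β x).le hBnn
      have h2 : 0 ≤ ε / 2 * w β x := mul_nonneg (half_pos hε).le (hw_pos β x).le
      linarith
  -- integrate
  have hint_gw : Integrable (fun x => g x * w β x) μ := integrable_of_continuous μ (hg.mul (hwc β))
  have hint_w : Integrable (w β) μ := integrable_of_continuous μ (hwc β)
  have hnum : (∫ x, g x * w β x ∂μ) - c * ∫ x, w β x ∂μ = ∫ x, (g x - c) * w β x ∂μ := by
    rw [← integral_const_mul, ← integral_sub hint_gw (hint_w.const_mul c)]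
    refine integral_congr_ae (ae_of_all _ fun x => ?_)
    ring
  have hbound : |(∫ x, g x * w β x ∂μ) - c * ∫ x, w β x ∂μ| ≤
      ε / 2 * (∫ x, w β x ∂μ) + B * Real.exp (-β * δ) * U := by
    rw [hnum]
    calc |∫ x, (g x - c) * w β x ∂μ| ≤ ∫ x, |(g x - c) * w β x| ∂μ := abs_integral_le_integral_abs
      _ ≤ ∫ x, (ε / 2 * w β x + B * Real.exp (-β * δ)) ∂μ := by
          refine integral_mono ?_ ((hint_w.const_mul _).add (integrable_const _)) hpt
          exact (integrable_of_continuous μ ((hg.sub continuous_const).mul (hwc β))).abs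
      _ = ε / 2 * (∫ x, w β x ∂μ) + B * Real.exp (-β * δ) * U := by
          rw [integral_add (hint_w.const_mul _) (integrable_const _), integral_const_mul,
            integral_const, smul_eq_mul, hU]
          ring
  -- divide by Z
  have hdiv : |(∫ x, g x * w β x ∂μ) / (∫ x, w β x ∂μ) - c| ≤
      ε / 2 + B * Real.exp (-β * δ) * U / ∫ x, w β x ∂μ := by
    have hZne : (∫ x, w β x ∂μ) ≠ 0 := hZ.ne'
    have : (∫ x, g x * w β x ∂μ) / (∫ x, w β x ∂μ) - c =
        ((∫ x, g x * w β x ∂μ) - c * ∫ x, w β x ∂μ) / ∫ x, w β x ∂μ := by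
      field_simp
    rw [this, abs_div, abs_of_pos hZ, div_le_iff₀ hZ]
    calc |(∫ x, g x * w β x ∂μ) - c * ∫ x, w β x ∂μ|
        ≤ ε / 2 * (∫ x, w β x ∂μ) + B * Real.exp (-β * δ) * U := hbound
      _ = (ε / 2 + B * Real.exp (-β * δ) * U / ∫ x, w β x ∂μ) * ∫ x, w β x ∂μ := by
          field_simp
  -- the tail in terms of exp(-β δ/2)
  have htail_le : B * Real.exp (-β * δ) * U / (∫ x, w β x ∂μ) ≤
      B * U / m * Real.exp (-β * (δ / 2)) := by
    have hnum_nn : 0 ≤ B * Real.exp (-β * δ) * U :=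
      mul_nonneg (mul_nonneg hBnn (Real.exp_pos _).le) measureReal_nonneg
    have hden : Real.exp (-β * (δ / 2)) * m ≤ ∫ x, w β x ∂μ := hZ_ge β (δ / 2) hβ0 (half_pos hδ)
    have hden_pos : 0 < Real.exp (-β * (δ / 2)) * m := mul_pos (Real.exp_pos _) hm_pos
    calc B * Real.exp (-β * δ) * U / (∫ x, w β x ∂μ)
        ≤ B * Real.exp (-β * δ) * U / (Real.exp (-β * (δ / 2)) * m) :=
          div_le_div_of_nonneg_left hnum_nn hden_pos hden
      _ = B * U / m * Real.exp (-β * (δ / 2)) := by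
          have hsplit : Real.exp (-β * δ) = Real.exp (-β * (δ / 2)) * Real.exp (-β * (δ / 2)) := by
            rw [← Real.exp_add]; ring_nf
          rw [hsplit]
          field_simp
  have htail_lt : B * U / m * Real.exp (-β * (δ / 2)) < ε / 2 := hβ₁ β hβ1
  rw [Real.dist_eq]
  linarith

end Laplace

section Wilson

variable {G : Type} [Group G] [TopologicalSpace G] [IsTopologicalGroup G] [CompactSpace G]
  [MeasurableSpace G] [BorelSpace G] {N : ℕ}

omit [IsTopologicalGroup G] [CompactSpace G] [MeasurableSpace G] [BorelSpace G] in
/-- A faithful continuous matrix representation makes the compact group second countable. -/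
theorem secondCountable_of_latticeRep [CompactSpace G] (r : LatticeRep G) :
    SecondCountableTopology G :=
  (r.continuous.isClosedEmbedding r.injective).isEmbedding.secondCountableTopology

omit [TopologicalSpace G] [IsTopologicalGroup G] [CompactSpace G] [MeasurableSpace G]
  [BorelSpace G] in
/-- `Re tr M ≤ N` for a unitary `N × N` matrix. -/
theorem re_trace_le_of_mem_unitaryGroup {M : Matrix (Fin N) (Fin N) ℂ}
    (hM : M ∈ Matrix.unitaryGroup (Fin N) ℂ) : M.trace.re ≤ N := by
  have h : |M.trace.re| ≤ N := by
    calc |M.trace.re| ≤ ‖M.trace‖ := Complex.abs_re_le_norm _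
      _ = ‖∑ i, M i i‖ := rfl
      _ ≤ ∑ i, ‖M i i‖ := norm_sum_le _ _
      _ ≤ ∑ _i : Fin N, (1 : ℝ) := Finset.sum_le_sum fun i _ => entry_norm_bound_of_unitary hM i i
      _ = N := by simp
  exact (abs_le.1 h).2

omit [IsTopologicalGroup G] [CompactSpace G] [MeasurableSpace G] [BorelSpace G] in
/-- Plaquette holonomies depend continuously on the configuration. -/
theorem continuous_plaquetteHolonomy [IsTopologicalGroup G] {S : ℕ} (x : Site 4 S) (i j : Fin 4) :
    Continuous fun U : GaugeConfig 4 S G => plaquetteHolonomy U x i j := by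
  unfold plaquetteHolonomy
  fun_prop

omit [CompactSpace G] [MeasurableSpace G] [BorelSpace G] in
/-- The Wilson action of a finite torus is continuous (continuous `ρ`). -/
theorem continuous_wilsonAction {S : ℕ} [NeZero S] (ρ : G →* Matrix (Fin N) (Fin N) ℂ)
    (hρ : Continuous ρ) : Continuous (wilsonAction (d := 4) (L := S) ρ) := by
  unfold wilsonAction
  refine continuous_finsetSum _ fun _ _ => ?_
  exact continuous_const.sub ((continuous_trace_re ρ hρ).comp (continuous_plaquetteHolonomy _ _ _))

omit [TopologicalSpace G] [IsTopologicalGroup G] [CompactSpace G] [MeasurableSpace G]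
  [BorelSpace G] in
/-- The Wilson action is non-negative when `Re tr ρ ≤ N` (unitary `ρ`). -/
theorem wilsonAction_nonneg {S : ℕ} [NeZero S] (ρ : G →* Matrix (Fin N) (Fin N) ℂ)
    (hρN : ∀ g, (ρ g).trace.re ≤ N) (U : GaugeConfig 4 S G) : 0 ≤ wilsonAction ρ U :=
  Finset.sum_nonneg fun _ _ => sub_nonneg.2 (hρN _)

omit [TopologicalSpace G] [IsTopologicalGroup G] [CompactSpace G] [MeasurableSpace G]
  [BorelSpace G] in
/-- The trivial configuration has zero Wilson action. -/
theorem wilsonAction_one {S : ℕ} [NeZero S] (ρ : G →* Matrix (Fin N) (Fin N) ℂ) :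
    wilsonAction ρ (fun _ : Edge 4 S => (1 : G)) = 0 := by
  unfold wilsonAction plaquetteHolonomy
  simp [Matrix.trace_one]

omit [TopologicalSpace G] [IsTopologicalGroup G] [CompactSpace G] [MeasurableSpace G]
  [BorelSpace G] in
/-- On the zero set of the Wilson action every plaquette trace is maximal. -/
theorem re_trace_eq_of_wilsonAction_eq_zero {S : ℕ} [NeZero S] (ρ : G →* Matrix (Fin N) (Fin N) ℂ)
    (hρN : ∀ g, (ρ g).trace.re ≤ N) {U : GaugeConfig 4 S G} (hU : wilsonAction ρ U = 0)
    (x : Site 4 S) (i j : Fin 4) (hij : i < j) :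
    (ρ (plaquetteHolonomy U x i j)).trace.re = N := by
  have h := (Finset.sum_eq_zero_iff_of_nonneg (fun p _ => sub_nonneg.2 (hρN _))).1 hU
    (x, ⟨(i, j), hij⟩) (Finset.mem_univ _)
  simp only at h
  linarith

/-- **Wilson expectations as Gibbs averages against product Haar measure.** -/
theorem integral_wilsonMeasure_eq_div [SecondCountableTopology G] {S : ℕ} [NeZero S]
    (ρ : G →* Matrix (Fin N) (Fin N) ℂ) (hρ : Continuous ρ) (β : ℝ) (F : GaugeConfig 4 S G → ℝ) :
    ∫ U, F U ∂(wilsonMeasure ρ β) =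
      (∫ U, F U * Real.exp (-β * wilsonAction ρ U)
          ∂(Measure.pi fun _ : Edge 4 S => haarProbability G)) /
        ∫ U, Real.exp (-β * wilsonAction ρ U) ∂(Measure.pi fun _ : Edge 4 S => haarProbability G) := by
  have hw : Measurable fun U : GaugeConfig 4 S G =>
      ENNReal.ofReal (Real.exp (-β * wilsonAction ρ U)) :=
    (Real.measurable_exp.comp ((measurable_wilsonAction ρ hρ).const_mul _)).ennreal_ofReal
  have hZ : partitionFunction (d := 4) (L := S) ρ β =
      ∫⁻ U, ENNReal.ofReal (Real.exp (-β * wilsonAction ρ U))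
        ∂(Measure.pi fun _ : Edge 4 S => haarProbability G) := by
    simp only [partitionFunction, wilsonWeight, withDensity_apply _ MeasurableSet.univ,
      Measure.restrict_univ]
  have hZreal : (partitionFunction (d := 4) (L := S) ρ β).toReal =
      ∫ U, Real.exp (-β * wilsonAction ρ U) ∂(Measure.pi fun _ : Edge 4 S => haarProbability G) := by
    rw [hZ, integral_eq_lintegral_of_nonneg_ae (ae_of_all _ fun U => (Real.exp_pos _).le)]
    exact (Real.measurable_exp.comp ((measurable_wilsonAction ρ hρ).const_mul _)).aestronglyMeasurable
  unfold wilsonMeasure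
  rw [integral_smul_measure, wilsonWeight, integral_withDensity_eq_integral_toReal_smul hw
    (ae_of_all _ fun _ => ENNReal.ofReal_lt_top), ENNReal.toReal_inv, hZreal, smul_eq_mul,
    inv_mul_eq_div]
  congr 1
  refine integral_congr_ae (ae_of_all _ fun U => ?_)
  beta_reduce
  rw [ENNReal.toReal_ofReal (Real.exp_pos _).le, smul_eq_mul, mul_comm]

/-- **Freezing of Wilson expectations**: for a continuous observable `F` on a FIXED torus which is
constant `= c` on the flat configurations (zero set of the Wilson action),
`⟨F⟩_β → c` as `β → ∞`. -/
theorem tendsto_integral_wilsonMeasure [SecondCountableTopology G] {S : ℕ} [NeZero S]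
    (ρ : G →* Matrix (Fin N) (Fin N) ℂ) (hρ : Continuous ρ) (hρN : ∀ g, (ρ g).trace.re ≤ N)
    {F : GaugeConfig 4 S G → ℝ} (hF : Continuous F) {c : ℝ}
    (hFc : ∀ U, wilsonAction ρ U = 0 → F U = c) :
    Tendsto (fun β : ℝ => ∫ U, F U ∂(wilsonMeasure ρ β)) atTop (𝓝 c) := by
  haveI : (haarProbability G).IsOpenPosMeasure := by unfold haarProbability; infer_instance
  haveI : IsFiniteMeasure (haarProbability G) := by unfold haarProbability; infer_instance
  simp only [integral_wilsonMeasure_eq_div ρ hρ]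
  exact tendsto_laplaceAverage (Measure.pi fun _ : Edge 4 S => haarProbability G)
    (continuous_wilsonAction ρ hρ) hF (wilsonAction_nonneg ρ hρN) (wilsonAction_one ρ) hFc

omit [TopologicalSpace G] [IsTopologicalGroup G] [CompactSpace G] [MeasurableSpace G]
  [BorelSpace G] in
/-- Plaquette holonomies of the periodic lift are the torus holonomies below. -/
theorem plaquetteHolonomyZd_torusLift' {S : ℕ} (U : GaugeConfig 4 S G)
    (y : Literature.Probability.LatticeModels.Site 4) (i j : Fin 4) :
    plaquetteHolonomyZd (torusLift S U) y i j =
      plaquetteHolonomy U (Literature.Probability.LatticeModels.Torus.proj S y) i j := by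
  simp only [plaquetteHolonomyZd, plaquetteHolonomy, torusLift, torusEdge, Function.comp_apply,
    Site.shift, torusProj_add_single, Int.cast_one]

omit [TopologicalSpace G] [IsTopologicalGroup G] [CompactSpace G] [BorelSpace G] in
/-- Plaquette holonomies of a translated configuration. -/
theorem plaquetteHolonomyZd_configShift (v : Literature.Probability.LatticeModels.Site 4)
    (W : LGConfig 4 G) (x : Literature.Probability.LatticeModels.Site 4) (i j : Fin 4) :
    plaquetteHolonomyZd (configShift v W) x i j = plaquetteHolonomyZd W (x - v) i j := by
  simp only [plaquetteHolonomyZd, configShift_apply, add_sub_right_comm]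

omit [TopologicalSpace G] [IsTopologicalGroup G] [CompactSpace G] [BorelSpace G] in
/-- On flat configurations the (translated) action density of the lift is the constant
`∑_{i<j} N`. -/
theorem actionDensity_configShift_torusLift_eq {S : ℕ} [NeZero S]
    (ρ : G →* Matrix (Fin N) (Fin N) ℂ) (hρN : ∀ g, (ρ g).trace.re ≤ N) {U : GaugeConfig 4 S G}
    (hU : wilsonAction ρ U = 0) (v : Literature.Probability.LatticeModels.Site 4) :
    actionDensity ρ (configShift v (torusLift S U)) =
      ∑ i : Fin 4, ∑ j : Fin 4, if i < j then (N : ℝ) else 0 := by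
  unfold actionDensity
  refine Finset.sum_congr rfl fun i _ => Finset.sum_congr rfl fun j _ => ?_
  split_ifs with hij
  · simp only [plaquetteObs, plaquetteHolonomyZd_configShift, plaquetteHolonomyZd_torusLift']
    exact re_trace_eq_of_wilsonAction_eq_zero ρ hρN hU _ i j hij
  · rfl

omit [TopologicalSpace G] [IsTopologicalGroup G] [CompactSpace G] [MeasurableSpace G]
  [BorelSpace G] in
/-- On flat configurations the action density of the lift is the constant `∑_{i<j} N`. -/
theorem actionDensity_torusLift_eq {S : ℕ} [NeZero S]
    (ρ : G →* Matrix (Fin N) (Fin N) ℂ) (hρN : ∀ g, (ρ g).trace.re ≤ N) {U : GaugeConfig 4 S G}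
    (hU : wilsonAction ρ U = 0) :
    actionDensity ρ (torusLift S U) = ∑ i : Fin 4, ∑ j : Fin 4, if i < j then (N : ℝ) else 0 := by
  unfold actionDensity
  refine Finset.sum_congr rfl fun i _ => Finset.sum_congr rfl fun j _ => ?_
  split_ifs with hij
  · simp only [plaquetteObs, plaquetteHolonomyZd_torusLift']
    exact re_trace_eq_of_wilsonAction_eq_zero ρ hρN hU _ i j hij
  · rfl

omit [Group G] [IsTopologicalGroup G] [CompactSpace G] [MeasurableSpace G] [BorelSpace G] in
/-- The periodic lift is continuous. -/
theorem continuous_torusLift (S : ℕ) : Continuous (torusLift (d := 4) (G := G) S) := by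
  unfold torusLift
  fun_prop

/-- **Freezing kills every connected curvature correlator on a fixed torus**: for every compact
`G`, every faithful unitary `r`, every torus side `S` and separation `m`,
`⟨P ; τ_m P⟩_{β, S} → 0` as `β → ∞` (the measure concentrates on flat configurations, where the
action density is constant). This is the upper endpoint `N_1(k, β) → 0` (`β → ∞`, `k` fixed) of the
planner's IVT, and the engine of the ceiling theorem below. -/
theorem latticeConnectedCorr_curvature_tendsto_zero (r : LatticeRep G) (S : ℕ) [NeZero S]
    (m : ℕ) :
    Tendsto (fun β : ℝ => latticeConnectedCorr r.ρ β S r.curvature.F r.curvature.F m)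
      atTop (𝓝 0) := by
  haveI : SecondCountableTopology G := secondCountable_of_latticeRep r
  have hρN : ∀ g, (r.ρ g).trace.re ≤ r.N := fun g => re_trace_le_of_mem_unitaryGroup (r.mem_unitary g)
  set c : ℝ := ∑ i : Fin 4, ∑ j : Fin 4, if i < j then (r.N : ℝ) else 0 with hc
  have hF : ∀ W, r.curvature.F W = actionDensity r.ρ W := fun W => rfl
  have hlift := continuous_torusLift (G := G) S
  have hA : Continuous fun U : GaugeConfig 4 S G => actionDensity r.ρ (torusLift S U) :=
    (continuous_actionDensity r.continuous).comp hlift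
  have hB : Continuous fun U : GaugeConfig 4 S G =>
      actionDensity r.ρ (configShift (-Pi.single 0 (m : ℤ)) (torusLift S U)) :=
    (continuous_actionDensity r.continuous).comp ((continuous_configShift _).comp hlift)
  have h1 := tendsto_integral_wilsonMeasure r.ρ r.continuous hρN
    (F := fun U : GaugeConfig 4 S G => actionDensity r.ρ (torusLift S U) *
      actionDensity r.ρ (configShift (-Pi.single 0 (m : ℤ)) (torusLift S U))) (hA.mul hB)
    (c := c * c) fun U hU => by
      simp only [actionDensity_torusLift_eq r.ρ hρN hU,
        actionDensity_configShift_torusLift_eq r.ρ hρN hU, hc]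
  have h2 := tendsto_integral_wilsonMeasure r.ρ r.continuous hρN hA (c := c)
    fun U hU => by simp only [actionDensity_torusLift_eq r.ρ hρN hU, hc]
  have h := h1.sub (h2.mul h2)
  rw [sub_self] at h
  simpa only [latticeConnectedCorr, hF] using h

end Wilson

end Summit.QuantumFields.YangMills.Theorems.TunedSequenceExists.Negative.Freezing

end
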